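import Summits.ABC.StewartYu.PadicG3SatSupply
import Summits.ABC.StewartYu.PadicG3SatFrame
import Summits.ABC.StewartYu.PadicG3RecordR3
import HarnessLib

/-!
# Cell abc-stewartyu, WP-L.P(odd) (crux r3 `PadicCoreOddRat`, stmt-ABC-20503): the RECORD INTERFACE of the saturated frame over a schedule —
# closed forms (`LcS`, `svS`, `UcardSat`, `XbSSat`, `AmaxSat`, `PmaxSat`), the named inequalities `IneqPackSat`, and
# `recordSupplyAtSatR_of_ineq` / `_of_pack`

`Summits/ABC/StewartYu/PadicG3SatRecord.lean` — cell `abc-stewartyu` (HOME `run/shared/lean/pub/abc-stewartyu/`, design memo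
HOME/p2/memo-07-WPLP-odd-Nframe-design.md §2 rows «ceilings» / «schedules/packs»; seat p2-g6).  Definitions (closed forms, `IneqPackSat`) and
theorems on `G3Setup`; no named fact, no parameters.  Twin of `PadicG3RecordR2`/`R3` (`recordSupplyAtR₃_of_ineq`, `IneqPackR₃`,
`recordSupplyAtR₃_of_pack`) over the landed schedule structure `G3Sched` (`sideS₂ j = ⌊Lbox/(2Aⱼ)⌋` = the α-box half-sides `sⱼ`), with

* `svS F Sc j = N·sⱼ` (virtual half-sides), `LcS F Sc k = Σⱼ sⱼ·|Cⱼₖ|` (θ-box), `UcardSat F Sc = (L₀+1)·#satFam F LcS svS` (unknown count),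
  `XbSSat` (START directional bound on the θ-box `Lb LcS 0`), `AmaxSat = M0C·XbSSat^{T₀}·Dm(Lb svS 0, X₀)²` (Siegel entry bound),
  `PmaxSat = ⌈UcardSat·AmaxSat⌉`;
* `IneqPackSat S F Sc` — the five named inequalities (B1 count over the skew family, level-0 k-steps, half-steps with `DCsat`/`MhCsat`,
  odd-node k-steps, symmetric k-steps of levels ≥ 1, all with `KCsat`) — WHAT THE RECORD (p1 `PadicG3ParN` + pack) PROVES;
* **`recordSupplyAtSatR_of_ineq`**, **`recordSupplyAtSatR_of_pack`** — `IneqPackSat` + the `Λ`-order line + END sizing + `RecordOdd` ⇒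
  `RecordSupplyAtSatR S F C V Vmax W` (the hypothesis of `frameOddRatPos_of_recordSatR`).

WHAT THIS IS NOT: the schedule's numbers and the proof of `IneqPackSat` (record seats); no crux moves.

References: Yu. V. Nesterenko, LNM 1819 (2003) Prop 4.1, §5; K. Yu, Acta Math. 211 (2013) §§4–5.
-/

noncomputable section

open NormedSpace Finset Polynomial
open scoped Matrix
open Literature.NumberTheory.Transcendental
open Literature.NumberTheory.Transcendental.PadicCW77 (condExp)
open Literature.NumberTheory.Transcendental.CW77.Setup (Tau tauNorm)
open Summit.ABC.StewartYu.GenThreeFrameSpecOdd (RecordOdd)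
open scoped Nat

namespace Summit.ABC.StewartYu

namespace G3Setup

variable {p : ℕ} [Fact p.Prime] (S : G3Setup p) (F : S.SatData) (Sc : G3Sched S.n)

/-! ### Closed forms of the saturated START -/

/-- The virtual half-sides `N·sⱼ`. [cite: Nesterenko2003, §3.5; shape only] -/
def svS (j : Fin S.n) : ℕ := F.N * S.sideS₂ Sc j

/-- The θ-box half-sides `Σⱼ sⱼ·|Cⱼₖ|` of the skew family. [cite: Nesterenko2003, §3.5; shape only] -/
def LcS (k : Fin S.n) : ℕ := (∑ j, (S.sideS₂ Sc j : ℤ) * |F.C j k|).toNat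

/-- `Σⱼ sⱼ·|Cⱼₖ| ≤ LcS k` (indeed `=`). [folklore] -/
theorem sum_side_mul_abs_le_LcS (k : Fin S.n) : ∑ j, (S.sideS₂ Sc j : ℤ) * |F.C j k| ≤ (S.LcS F Sc k : ℤ) := by
  unfold LcS
  rw [Int.toNat_of_nonneg (sum_nonneg fun j _ => mul_nonneg (by positivity) (abs_nonneg _))]

/-- The unknown count `(L₀+1)·#satFam`. [folklore] -/
def UcardSat : ℕ := (Sc.L₀ + 1) * (S.satFam F (S.LcS F Sc) (S.svS F Sc)).card

/-- `#unk L₀ 𝔏 ≤ UcardSat` for `𝔏 ⊆ satFam`. [folklore] -/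
theorem card_unk_le_UcardSat {𝔏 : Finset (Fin S.n → ℤ)} (h𝔏 : 𝔏 ⊆ S.satFam F (S.LcS F Sc) (S.svS F Sc)) :
    (S.unk Sc.L₀ 𝔏).card ≤ S.UcardSat F Sc := by
  unfold UcardSat
  rw [S.card_unk]
  exact Nat.mul_le_mul_left _ (card_le_card h𝔏)

/-- The directional bound of the START (`≥ 1`) on the θ-box `Lb LcS 0`. [folklore] -/
def XbSSat : ℤ := max 1 (S.XbC (S.Lb (S.LcS F Sc) 0))

/-- The Siegel entry bound of the START with the VIRTUAL denominator: `M0C·XbSSat^{T₀}·Dm(Lb svS 0, X₀)²`. [folklore] -/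
def AmaxSat : ℝ :=
  (M0C Sc.L₀ Sc.H Sc.Sd 0 (S.NS Sc 0 0 : ℤ) (S.TordS Sc 0 0) : ℝ) * (S.XbSSat F Sc : ℝ) ^ (S.TordS Sc 0 0) *
    ((F.Dm (S.Lb (S.svS F Sc) 0) (S.NS Sc 0 0 : ℤ) : ℝ)) ^ 2

/-- The coefficient bound of Siegel's lemma, uniform in the class. [folklore] -/
def PmaxSat : ℤ := ⌈(S.UcardSat F Sc : ℝ) * S.AmaxSat F Sc⌉

/-- `1 ≤ M0C` (real form). [folklore] -/
private theorem one_le_M0C_real (L₀ H Sh lev : ℕ) (x : ℤ) (t₀ : ℕ) : (1 : ℝ) ≤ (M0C L₀ H Sh lev x t₀ : ℝ) := by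
  have h1 : (1 : ℤ) ≤ M0C L₀ H Sh lev x t₀ := by
    unfold M0C
    refine Int.one_le_ceil_iff.mpr ?_
    have hb : (1 : ℝ) ≤ Real.exp 1 * (1 + |((2 ^ (Sh - lev) * x : ℤ) : ℝ)| / H) := by
      have : (1 : ℝ) ≤ Real.exp 1 := Real.one_le_exp zero_le_one
      have : (0 : ℝ) ≤ |((2 ^ (Sh - lev) * x : ℤ) : ℝ)| / H := by positivity
      nlinarith
    have h2 : (1 : ℝ) ≤ (2 : ℝ) ^ ((Sh - lev) * t₀) := one_le_pow₀ (by norm_num)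
    have h3 : (1 : ℝ) ≤ (Nat.lcmUpto H : ℝ) ^ t₀ := one_le_pow₀ (by exact_mod_cast Nat.lcmUpto_pos H)
    have h4 : (1 : ℝ) ≤ Real.exp (H / Real.exp 1) := Real.one_le_exp (by positivity)
    have h5 : (1 : ℝ) ≤ (Real.exp 1 * (1 + |((2 ^ (Sh - lev) * x : ℤ) : ℝ)| / H)) ^ L₀ := one_le_pow₀ hb
    have h6 := one_le_mul_of_one_le_of_one_le h2 (one_le_mul_of_one_le_of_one_le h3 (one_le_mul_of_one_le_of_one_le h4 h5))
    linarith
  exact_mod_cast h1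

/-- `1 ≤ AmaxSat`. [folklore] -/
theorem one_le_AmaxSat : (1 : ℝ) ≤ S.AmaxSat F Sc := by
  unfold AmaxSat
  have hM := one_le_M0C_real Sc.L₀ Sc.H Sc.Sd 0 (S.NS Sc 0 0 : ℤ) (S.TordS Sc 0 0)
  have hX : (1 : ℝ) ≤ (S.XbSSat F Sc : ℝ) := by unfold XbSSat; exact_mod_cast le_max_left _ _
  have hm : (1 : ℝ) ≤ (F.Dm (S.Lb (S.svS F Sc) 0) (S.NS Sc 0 0 : ℤ) : ℝ) := by exact_mod_cast F.one_le_Dm _ _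
  calc (1 : ℝ) = 1 * 1 * 1 := by ring
    _ ≤ _ := mul_le_mul (mul_le_mul hM (one_le_pow₀ hX) zero_le_one (by positivity)) (one_le_pow₀ hm) zero_le_one (by positivity)

/-- `0 ≤ PmaxSat`. [folklore] -/
theorem PmaxSat_nonneg : (0 : ℤ) ≤ S.PmaxSat F Sc := by
  unfold PmaxSat; exact Int.ceil_nonneg (mul_nonneg (Nat.cast_nonneg _) (le_trans zero_le_one (S.one_le_AmaxSat F Sc)))

/-- `Dm` is monotone in `|x|`. [folklore] -/
theorem Dm_mono_abs (Bv : Fin S.n → ℕ) {x x' : ℤ} (h : |x| ≤ |x'|) : F.Dm Bv x ≤ F.Dm Bv x' := by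
  unfold SatData.Dm MonomialDen.monDen
  refine prod_le_prod' fun j _ => Nat.pow_le_pow_right (MonomialDen.one_le_qsize (F.αo_ne j)) ?_
  unfold SatData.E
  have : x.natAbs ≤ x'.natAbs := by
    have h1 : (x.natAbs : ℤ) ≤ x'.natAbs := by rwa [Int.natCast_natAbs, Int.natCast_natAbs]
    exact_mod_cast h1
  exact Nat.div_le_div_right (by have := Nat.mul_le_mul_left (Bv j) this; omega)

/-- `KCsat` is monotone in `U`, `P` and `|x|`. [folklore] -/
theorem KCsat_mono {U U' : ℕ} {Pc Pc' : ℤ} (hU : U ≤ U') (hP0 : 0 ≤ Pc) (hP : Pc ≤ Pc') (L₀ H Sh lev : ℕ) (Lc Bv : Fin S.n → ℕ)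
    {x x' : ℤ} (hx : |x| ≤ |x'|) (τ : Tau S.n) :
    S.KCsat F U Pc L₀ H Sh lev Lc Bv x τ ≤ S.KCsat F U' Pc' L₀ H Sh lev Lc Bv x' τ := by
  unfold KCsat
  have hM : (0 : ℝ) ≤ M0C L₀ H Sh lev x τ.1 := le_trans zero_le_one (one_le_M0C_real L₀ H Sh lev x τ.1)
  have hMM : (M0C L₀ H Sh lev x τ.1 : ℝ) ≤ M0C L₀ H Sh lev x' τ.1 := by exact_mod_cast M0C_mono L₀ H Sh lev hx le_rfl
  have hX : (0 : ℝ) ≤ S.XbC Lc := by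
    have h0 : (0 : ℤ) ≤ S.XbC Lc := by
      unfold XbC
      exact mul_nonneg (by norm_num) (mul_nonneg (sum_nonneg fun j _ => abs_nonneg _) (sum_nonneg fun j _ => by positivity))
    exact_mod_cast h0
  have hmon : (F.Dm Bv x : ℝ) ≤ F.Dm Bv x' := by exact_mod_cast S.Dm_mono_abs F Bv hx
  have hP0' : (0 : ℝ) ≤ Pc := by exact_mod_cast hP0
  have hP' : (Pc : ℝ) ≤ Pc' := by exact_mod_cast hP
  have hU' : (U : ℝ) ≤ U' := by exact_mod_cast hU
  have hfac : (M0C L₀ H Sh lev x τ.1 : ℝ) * (S.XbC Lc : ℝ) ^ (∑ k, τ.2 k) * ((F.Dm Bv x : ℝ)) ^ 2 ≤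
      (M0C L₀ H Sh lev x' τ.1 : ℝ) * (S.XbC Lc : ℝ) ^ (∑ k, τ.2 k) * ((F.Dm Bv x' : ℝ)) ^ 2 :=
    mul_le_mul (mul_le_mul_of_nonneg_right hMM (by positivity)) (pow_le_pow_left₀ (by positivity) hmon 2) (by positivity)
      (mul_nonneg (le_trans hM hMM) (by positivity))
  have hM' : (0 : ℝ) ≤ M0C L₀ H Sh lev x' τ.1 := le_trans hM hMM
  have h0' : 0 ≤ (M0C L₀ H Sh lev x' τ.1 : ℝ) * (S.XbC Lc : ℝ) ^ (∑ k, τ.2 k) * ((F.Dm Bv x' : ℝ)) ^ 2 := by positivity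
  have hUP : (U : ℝ) * Pc ≤ (U' : ℝ) * Pc' := mul_le_mul hU' hP' hP0' (le_trans (Nat.cast_nonneg _) hU')
  have hUP0 : (0 : ℝ) ≤ (U : ℝ) * Pc := mul_nonneg (Nat.cast_nonneg _) hP0'
  have h1 := mul_le_mul hUP hfac (by positivity) (le_trans hUP0 hUP)
  linarith

/-! ### The record's named inequalities -/

/-- **The record's named inequalities for the saturated frame over the schedule `Sc`**: (B1) the restricted Siegel count over the skew
family; the level-0 k-steps; the Kummer half-steps (`DCsat`/`MhCsat`); the odd-node k-steps; the symmetric k-steps of the levels `≥ 1` — all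
with the virtual currency `KCsat` and the uniform coefficient bound `PmaxSat`. [cite: Nesterenko2003, Prop 4.1, Lemma 4.3, §4.3; shape only] -/
def IneqPackSat : Prop :=
  (2 * (Icc (-(S.NS Sc 0 0 : ℤ)) (S.NS Sc 0 0) ×ˢ tauSetR S.n S.j₀ (S.TordS Sc 0 0)).card * ((p - 1) * p ^ Sc.m) ≤
      (Sc.L₀ + 1) * (S.satFam F (S.LcS F Sc) (S.svS F Sc)).card) ∧
  (∀ ν < S.n, ∀ x₁ : ℤ, |x₁| ≤ (S.NS Sc 0 (ν + 1) : ℤ) → ∀ τ : Tau S.n, tauNorm τ + S.tS Sc 0 ≤ S.TordS Sc 0 ν →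
      max (BwP (p := p) Sc.L₀ Sc.m * ‖S.Λ / (S.b S.j₀ : ℚ_[p])‖ * (p : ℝ) ^ ((S.tS Sc 0 - 1) / 2) *
            (p : ℝ) ^ condExp p (2 * S.NS Sc 0 ν + 1) (S.tS Sc 0))
        (BwP (p := p) Sc.L₀ Sc.m / ((p : ℝ) ^ Sc.m * Real.sqrt p) ^ ((2 * S.NS Sc 0 ν + 1) * S.tS Sc 0)) <
      1 / S.KCsat F (S.UcardSat F Sc) (S.PmaxSat F Sc) Sc.L₀ Sc.H Sc.Sd 0 (S.Lb (S.LcS F Sc) 0) (S.Lb (S.svS F Sc) 0) x₁ τ) ∧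
  (∀ lev < Sc.Sd, ∀ s₁ : ℤ, Odd s₁ → |s₁| ≤ (2 * S.NhS Sc (lev + 1) - 1 : ℤ) → ∀ τ : Tau S.n, tauNorm τ + S.tS Sc lev ≤ S.TordS Sc lev S.n →
      max (BwP (p := p) Sc.L₀ Sc.m * ‖S.Λ / (S.b S.j₀ : ℚ_[p])‖ * (p : ℝ) ^ ((S.tS Sc lev - 1) / 2) *
            (p : ℝ) ^ condExp p (2 * S.NS Sc lev S.n + 1) (S.tS Sc lev))
        (BwP (p := p) Sc.L₀ Sc.m / ((p : ℝ) ^ Sc.m * Real.sqrt p) ^ ((2 * S.NS Sc lev S.n + 1) * S.tS Sc lev)) <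
      (S.DCsat F (S.Lb (S.svS F Sc) lev) Sc.H s₁ τ : ℝ) /
        (4 * (S.DCsat F (S.Lb (S.svS F Sc) lev) Sc.H s₁ τ : ℝ) ^ 2 *
          (1 + (S.UcardSat F Sc : ℝ) * (S.PmaxSat F Sc) *
            S.MhCsat F (S.Lb (S.LcS F Sc) lev) (S.Lb (S.svS F Sc) lev) Sc.L₀ Sc.H Sc.Sd lev s₁ τ) *
          CW77.heightProd S.α ^ 3) ^ (2 ^ (S.n + 1))) ∧
  (∀ lev < Sc.Sd, ∀ x₁ : ℤ, |x₁| ≤ (S.NS Sc (lev + 1) 1 : ℤ) → ∀ τ : Tau S.n, tauNorm τ + S.tS Sc (lev + 1) ≤ S.TordS Sc (lev + 1) 0 →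
      max (BwP (p := p) Sc.L₀ Sc.m * ‖S.Λ / (S.b S.j₀ : ℚ_[p])‖ * (p : ℝ) ^ ((S.tS Sc (lev + 1) - 1) / 2) *
            (p : ℝ) ^ condExp p (2 * S.NhS Sc (lev + 1)) (S.tS Sc (lev + 1)))
        (BwP (p := p) Sc.L₀ Sc.m / ((p : ℝ) ^ Sc.m * Real.sqrt p) ^ ((2 * S.NhS Sc (lev + 1)) * S.tS Sc (lev + 1))) <
      1 / S.KCsat F (S.UcardSat F Sc) (S.PmaxSat F Sc) Sc.L₀ Sc.H Sc.Sd (lev + 1) (S.Lb (S.LcS F Sc) (lev + 1))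
        (S.Lb (S.svS F Sc) (lev + 1)) x₁ τ) ∧
  (∀ lev < Sc.Sd, ∀ ν, 1 ≤ ν → ν < S.n → ∀ x₁ : ℤ, |x₁| ≤ (S.NS Sc (lev + 1) (ν + 1) : ℤ) →
      ∀ τ : Tau S.n, tauNorm τ + S.tS Sc (lev + 1) ≤ S.TordS Sc (lev + 1) ν →
      max (BwP (p := p) Sc.L₀ Sc.m * ‖S.Λ / (S.b S.j₀ : ℚ_[p])‖ * (p : ℝ) ^ ((S.tS Sc (lev + 1) - 1) / 2) *
            (p : ℝ) ^ condExp p (2 * S.NS Sc (lev + 1) ν + 1) (S.tS Sc (lev + 1)))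
        (BwP (p := p) Sc.L₀ Sc.m / ((p : ℝ) ^ Sc.m * Real.sqrt p) ^ ((2 * S.NS Sc (lev + 1) ν + 1) * S.tS Sc (lev + 1))) <
      1 / S.KCsat F (S.UcardSat F Sc) (S.PmaxSat F Sc) Sc.L₀ Sc.H Sc.Sd (lev + 1) (S.Lb (S.LcS F Sc) (lev + 1))
        (S.Lb (S.svS F Sc) (lev + 1)) x₁ τ)

/-! ### The supply from the named inequalities -/

/-- **THE SATURATED RECORD SUPPLY FROM THE NAMED INEQUALITIES** + the `Λ`-order line + END sizing + `RecordOdd`.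
[cite: Nesterenko2003, Prop 4.1, §5; shape only] -/
theorem recordSupplyAtSatR_of_pack (hn : 1 ≤ S.n) (C : ℕ → ℝ) (V : Fin S.n → ℝ) (Vmax W : ℝ) (X' S₀ D₀ : ℕ) (D : Fin S.n → ℕ)
    (hne : ∏ j, S.α j ^ S.b j ≠ 1)
    (hord : ((Sc.m + 1 : ℕ) : ℤ) + padicValInt p (S.b S.j₀) ≤ padicValRat p (∏ j, S.α j ^ S.b j - 1))
    (hpack : S.IneqPackSat F Sc)
    (hXfin : 2 * ((S.n + 1) * X') ≤ S.NS Sc Sc.Sd S.n) (hSfin : (S.n + 1) * S₀ < S.TordS Sc Sc.Sd S.n) (hD₀ : Sc.L₀ ≤ D₀)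
    (hD : ∀ j, 2 * S.Lb (S.svS F Sc) Sc.Sd j ≤ D j) (hrec : RecordOdd C p S.n V Vmax W D₀ S₀ X' D) :
    S.RecordSupplyAtSatR F C V Vmax W := by
  classical
  obtain ⟨hB1, hK0, hH, hO, hK⟩ := hpack
  have hH1 : 1 ≤ Sc.H := Sc.hH
  have hm1 : 1 ≤ Sc.m + 1 := by omega
  -- Λ
  have hΛm : ‖S.Λ / (S.b S.j₀ : ℚ_[p])‖ ≤ (p : ℝ)⁻¹ ^ (Sc.m + 1) := S.norm_Λ_div_le_of_padicValRat hm1 hne hord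
  have hΛ : ‖S.Λ / (S.b S.j₀ : ℚ_[p])‖ ≤ (p : ℝ)⁻¹ := by
    refine hΛm.trans ?_
    rw [pow_succ]
    exact mul_le_of_le_one_left (inv_nonneg.mpr S.p_pos.le)
      (pow_le_one₀ (inv_nonneg.mpr S.p_pos.le) (inv_le_one_of_one_le₀ S.one_lt_p.le))
  -- abbreviations
  set side := S.sideS₂ Sc with hside
  set Lc := S.LcS F Sc with hLcdef
  set sv := S.svS F Sc with hsvdef
  set X₀ : ℕ := S.NS Sc 0 0 with hX₀
  set T₀ : ℕ := S.TordS Sc 0 0 with hT₀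
  set E : Finset (ℤ × Tau S.n) := Icc (-(X₀ : ℤ)) X₀ ×ˢ tauSetR S.n S.j₀ T₀ with hE
  have hT₀1 : 1 ≤ T₀ := by
    rw [hT₀]; unfold TordS remS
    have h1 : 1 ≤ S.n - 0 := by omega
    exact le_trans h1 ((Nat.le_add_left _ _).trans (Nat.le_add_left _ _))
  have hsv : sv = fun j => F.N * side j := rfl
  -- START data (closed forms)
  have hXb := S.hXb_closed (S.Lb Lc 0)
  have hXbS : ∀ w : Fin S.n → ℤ, (∀ k, |w k| ≤ ((2 * Lc k : ℕ) : ℤ)) → ∀ k, |S.𝔛 w k| ≤ S.XbSSat F Sc := by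
    intro w hw k
    refine le_trans (hXb w (fun j => ?_) k) (by unfold XbSSat; exact le_max_right _ _)
    have := hw j
    unfold Lb; exact this
  have hR0 : ∀ e ∈ E, ∀ ℓ₀ ≤ Sc.L₀, ∃ z₀ : ℤ,
      (((Nat.lcmUpto Sc.H) ^ e.2.1 : ℕ) : ℚ) * (hasseDeriv e.2.1 (S.Rl Sc.H Sc.Sd 0 (ℓ₀, 0))).eval (e.1 : ℚ) = z₀ ∧
        |z₀| ≤ M0C Sc.L₀ Sc.H Sc.Sd 0 e.1 e.2.1 := by
    intro e _ ℓ₀ hℓ₀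
    exact S.exists_int_lcm_pow_mul_hasse_Rl hH1 Sc.Sd 0 (ℓ₀, (0 : Fin S.n → ℤ)) e.2.1 e.1
      (S.M0C_spec (p := p) hH1 Sc.L₀ Sc.Sd 0 (ℓ₀, (0 : Fin S.n → ℤ)) hℓ₀ e.1 e.2.1)
  have hA : ∀ e ∈ E, (M0C Sc.L₀ Sc.H Sc.Sd 0 e.1 e.2.1 : ℝ) * (S.XbSSat F Sc : ℝ) ^ (∑ k, e.2.2 k) *
      ((F.Dm (fun j => 2 * (F.N * side j)) e.1 : ℝ)) ^ 2 ≤ S.AmaxSat F Sc := by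
    intro e he
    rw [hE, mem_product, mem_Icc, mem_tauSetR] at he
    obtain ⟨⟨h1, h2⟩, hτ, _⟩ := he
    have hxe : |e.1| ≤ |(X₀ : ℤ)| := by rw [abs_le]; rw [Nat.abs_cast]; exact ⟨h1, h2⟩
    have ht0 : e.2.1 ≤ T₀ := by unfold tauNorm at hτ; omega
    have hts : ∑ k, e.2.2 k ≤ T₀ := by unfold tauNorm at hτ; omega
    have hM : (M0C Sc.L₀ Sc.H Sc.Sd 0 e.1 e.2.1 : ℝ) ≤ M0C Sc.L₀ Sc.H Sc.Sd 0 (X₀ : ℤ) T₀ := by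
      exact_mod_cast M0C_mono Sc.L₀ Sc.H Sc.Sd 0 hxe ht0
    have hM0 : (0 : ℝ) ≤ M0C Sc.L₀ Sc.H Sc.Sd 0 e.1 e.2.1 := le_trans zero_le_one (one_le_M0C_real _ _ _ _ _ _)
    have hX1 : (1 : ℝ) ≤ (S.XbSSat F Sc : ℝ) := by unfold XbSSat; exact_mod_cast le_max_left _ _
    have hXp : (S.XbSSat F Sc : ℝ) ^ (∑ k, e.2.2 k) ≤ (S.XbSSat F Sc : ℝ) ^ T₀ := pow_le_pow_right₀ hX1 hts
    have hLb0 : (fun j => 2 * (F.N * side j)) = S.Lb sv 0 := by funext j; unfold Lb; rw [hsv]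
    have hmon : (F.Dm (fun j => 2 * (F.N * side j)) e.1 : ℝ) ≤ F.Dm (S.Lb sv 0) (X₀ : ℤ) := by
      rw [hLb0]; exact_mod_cast S.Dm_mono_abs F (S.Lb sv 0) hxe
    unfold AmaxSat
    have hm0 : (0 : ℝ) ≤ (F.Dm (fun j => 2 * (F.N * side j)) e.1 : ℝ) := by positivity
    exact mul_le_mul (mul_le_mul hM hXp (by positivity) (le_trans hM0 hM)) (pow_le_pow_left₀ hm0 hmon 2) (by positivity)
      (mul_nonneg (le_trans hM0 hM) (by positivity))
  refine ⟨Sc.m, side, Lc, Sc.L₀, Sc.H, Sc.Sd, X₀, T₀, S.NS Sc, S.TordS Sc, S.NhS Sc, X', S₀,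
    fun e => (Nat.lcmUpto Sc.H) ^ e.2.1, fun e => M0C Sc.L₀ Sc.H Sc.Sd 0 e.1 e.2.1, S.XbSSat F Sc, S.AmaxSat F Sc, D₀, D,
    hT₀1, rfl, rfl, hΛ, hΛm, S.sum_side_mul_abs_le_LcS F Sc, hB1, fun e _ => Nat.one_le_pow _ _ (Nat.lcmUpto_pos _), hR0, hXbS,
    S.one_le_AmaxSat F Sc, hA, ?_, hXfin, hSfin, hD₀, ?_, hrec⟩
  swap
  · intro j; have := hD j; rw [hsvdef] at this; exact this
  -- the packages, uniformly in the class
  intro 𝔏 h𝔏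
  set P𝔏 : ℤ := ⌈((S.unk Sc.L₀ 𝔏).card : ℝ) * S.AmaxSat F Sc⌉ with hP𝔏
  have hP𝔏0 : (0 : ℤ) ≤ P𝔏 := Int.ceil_nonneg (mul_nonneg (Nat.cast_nonneg _) (le_trans zero_le_one (S.one_le_AmaxSat F Sc)))
  have hU : (S.unk Sc.L₀ 𝔏).card ≤ S.UcardSat F Sc := S.card_unk_le_UcardSat F Sc h𝔏
  have hPP : P𝔏 ≤ S.PmaxSat F Sc := by
    rw [hP𝔏]; unfold PmaxSat
    exact Int.ceil_mono (mul_le_mul_of_nonneg_right (by exact_mod_cast hU) (le_trans zero_le_one (S.one_le_AmaxSat F Sc)))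
  -- monotone transfer of the k-step inequality
  have hKCle : ∀ (lev : ℕ) (x₁ : ℤ) (τ : Tau S.n),
      S.KCsat F (S.unk Sc.L₀ 𝔏).card P𝔏 Sc.L₀ Sc.H Sc.Sd lev (S.Lb Lc lev) (S.Lb sv lev) x₁ τ ≤
        S.KCsat F (S.UcardSat F Sc) (S.PmaxSat F Sc) Sc.L₀ Sc.H Sc.Sd lev (S.Lb Lc lev) (S.Lb sv lev) x₁ τ :=
    fun lev x₁ τ => S.KCsat_mono F hU hP𝔏0 hPP Sc.L₀ Sc.H Sc.Sd lev (S.Lb Lc lev) (S.Lb sv lev) le_rfl τ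
  have hKCpos : ∀ (lev : ℕ) (x₁ : ℤ) (τ : Tau S.n),
      0 < S.KCsat F (S.unk Sc.L₀ 𝔏).card P𝔏 Sc.L₀ Sc.H Sc.Sd lev (S.Lb Lc lev) (S.Lb sv lev) x₁ τ :=
    fun lev x₁ τ => lt_of_lt_of_le zero_lt_one (S.one_le_KCsat F _ hP𝔏0 Sc.L₀ Sc.H Sc.Sd lev _ _ x₁ τ)
  have htrans : ∀ (lev : ℕ) (x₁ : ℤ) (τ : Tau S.n) (a : ℝ),
      a < 1 / S.KCsat F (S.UcardSat F Sc) (S.PmaxSat F Sc) Sc.L₀ Sc.H Sc.Sd lev (S.Lb Lc lev) (S.Lb sv lev) x₁ τ →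
      a < 1 / S.KCsat F (S.unk Sc.L₀ 𝔏).card P𝔏 Sc.L₀ Sc.H Sc.Sd lev (S.Lb Lc lev) (S.Lb sv lev) x₁ τ :=
    fun lev x₁ τ a h => lt_of_lt_of_le h (one_div_le_one_div_of_le (hKCpos lev x₁ τ) (hKCle lev x₁ τ))
  -- monotone transfer of the half-step inequality
  have hHtrans : ∀ (lev : ℕ) (s₁ : ℤ) (τ : Tau S.n) (a : ℝ),
      a < (S.DCsat F (S.Lb sv lev) Sc.H s₁ τ : ℝ) / (4 * (S.DCsat F (S.Lb sv lev) Sc.H s₁ τ : ℝ) ^ 2 *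
        (1 + (S.UcardSat F Sc : ℝ) * (S.PmaxSat F Sc) * S.MhCsat F (S.Lb Lc lev) (S.Lb sv lev) Sc.L₀ Sc.H Sc.Sd lev s₁ τ) *
          CW77.heightProd S.α ^ 3) ^ (2 ^ (S.n + 1)) →
      a < (S.DCsat F (S.Lb sv lev) Sc.H s₁ τ : ℝ) / (4 * (S.DCsat F (S.Lb sv lev) Sc.H s₁ τ : ℝ) ^ 2 *
        (1 + ((S.unk Sc.L₀ 𝔏).card : ℝ) * P𝔏 * S.MhCsat F (S.Lb Lc lev) (S.Lb sv lev) Sc.L₀ Sc.H Sc.Sd lev s₁ τ) *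
          CW77.heightProd S.α ^ 3) ^ (2 ^ (S.n + 1)) := by
    intro lev s₁ τ a h
    refine lt_of_lt_of_le h ?_
    have hDpos : (0 : ℝ) < S.DCsat F (S.Lb sv lev) Sc.H s₁ τ := by exact_mod_cast S.one_le_DCsat F (S.Lb sv lev) Sc.H s₁ τ
    have hHp : (0 : ℝ) < CW77.heightProd S.α := lt_of_lt_of_le zero_lt_one (by exact_mod_cast CW77.one_le_heightProd S.α)
    have hMh : (0 : ℝ) ≤ S.MhCsat F (S.Lb Lc lev) (S.Lb sv lev) Sc.L₀ Sc.H Sc.Sd lev s₁ τ := S.MhCsat_nonneg F _ _ Sc.L₀ Sc.H Sc.Sd lev s₁ τ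
    have hUP : ((S.unk Sc.L₀ 𝔏).card : ℝ) * P𝔏 ≤ (S.UcardSat F Sc : ℝ) * (S.PmaxSat F Sc) :=
      mul_le_mul (by exact_mod_cast hU) (by exact_mod_cast hPP) (by exact_mod_cast hP𝔏0) (Nat.cast_nonneg _)
    have h1 : 0 < 4 * (S.DCsat F (S.Lb sv lev) Sc.H s₁ τ : ℝ) ^ 2 *
        (1 + ((S.unk Sc.L₀ 𝔏).card : ℝ) * P𝔏 * S.MhCsat F (S.Lb Lc lev) (S.Lb sv lev) Sc.L₀ Sc.H Sc.Sd lev s₁ τ) *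
          CW77.heightProd S.α ^ 3 := by
      have : (0 : ℝ) ≤ ((S.unk Sc.L₀ 𝔏).card : ℝ) * P𝔏 * S.MhCsat F (S.Lb Lc lev) (S.Lb sv lev) Sc.L₀ Sc.H Sc.Sd lev s₁ τ :=
        mul_nonneg (mul_nonneg (Nat.cast_nonneg _) (by exact_mod_cast hP𝔏0)) hMh
      positivity
    refine div_le_div_of_nonneg_left hDpos.le (pow_pos h1 _) (pow_le_pow_left₀ h1.le ?_ _)
    have : ((S.unk Sc.L₀ 𝔏).card : ℝ) * P𝔏 * S.MhCsat F (S.Lb Lc lev) (S.Lb sv lev) Sc.L₀ Sc.H Sc.Sd lev s₁ τ ≤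
        (S.UcardSat F Sc : ℝ) * (S.PmaxSat F Sc) * S.MhCsat F (S.Lb Lc lev) (S.Lb sv lev) Sc.L₀ Sc.H Sc.Sd lev s₁ τ :=
      mul_le_mul_of_nonneg_right hUP hMh
    exact mul_le_mul_of_nonneg_right (mul_le_mul_of_nonneg_left (by linarith) (by positivity)) (pow_pos hHp 3).le
  refine ⟨?_, ?_, ?_, ?_⟩
  · -- level 0 k-steps
    intro ν hν
    exact S.kStepHypSatU_of_ineqP F hH1 Sc.L₀ Sc.Sd 0 Sc.m 𝔏 (S.Lb Lc 0) (S.Lb sv 0) P𝔏 hP𝔏0 (S.one_le_tS Sc 0) (S.TordS_kstep Sc 0 ν hν)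
      (fun x₁ hx₁ τ hτ => htrans 0 x₁ τ _ (hK0 ν hν x₁ hx₁ τ hτ))
  · -- half-steps
    intro lev hlev
    exact S.halfStepHypSatU_of_ineqSharp F hH1 hlev Sc.L₀ Sc.m 𝔏 (S.Lb Lc lev) (S.Lb sv lev) P𝔏 (S.one_le_tS Sc lev)
      (S.TordS_half Sc lev (by omega)) (fun s₁ hs₁ hs₁' τ hτ => hHtrans lev s₁ τ _ (hH lev hlev s₁ hs₁ hs₁' τ hτ))
  · -- odd-node k-steps
    intro lev hlev
    exact S.kStepOddHypSatU_of_ineqP F hH1 Sc.L₀ Sc.Sd (lev + 1) Sc.m 𝔏 (S.Lb Lc (lev + 1)) (S.Lb sv (lev + 1)) P𝔏 hP𝔏0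
      (S.one_le_tS Sc (lev + 1)) (S.TordS_kstep Sc (lev + 1) 0 (by omega))
      (fun x₁ hx₁ τ hτ => htrans (lev + 1) x₁ τ _ (hO lev hlev x₁ hx₁ τ hτ))
  · -- symmetric k-steps of the levels ≥ 1
    intro lev hlev ν hν1 hνn
    exact S.kStepHypSatU_of_ineqP F hH1 Sc.L₀ Sc.Sd (lev + 1) Sc.m 𝔏 (S.Lb Lc (lev + 1)) (S.Lb sv (lev + 1)) P𝔏 hP𝔏0
      (S.one_le_tS Sc (lev + 1)) (S.TordS_kstep Sc (lev + 1) ν hνn)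
      (fun x₁ hx₁ τ hτ => htrans (lev + 1) x₁ τ _ (hK lev hlev ν hν1 hνn x₁ hx₁ τ hτ))

end G3Setup

end Summit.ABC.StewartYu

end
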